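import Mathlib
import HarnessLib
import Summits.ResolutionOfSingularities.ResolutionOfSingularities.Theorems.HomologicalConductorSurfaceTerminationGenusCover
import Summits.ResolutionOfSingularities.ResolutionOfSingularities.Theorems.HomologicalConductorSurfaceTerminationChartResolutionTowerSucc
import Summits.ResolutionOfSingularities.ResolutionOfSingularities.Theorems.HomologicalConductorSurfaceTerminationChartTriangle
import Summits.ResolutionOfSingularities.ResolutionOfSingularities.Theorems.HomologicalConductorSurfaceTerminationRationalDescent
import Summits.ResolutionOfSingularities.ResolutionOfSingularities.Theorems.HomologicalConductorPersistenceAffineChartEssFiniteType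
import Summits.ResolutionOfSingularities.ResolutionOfSingularities.Theorems.SyzygyFlatteningRankOneTerminationStageNormal
import Summits.ResolutionOfSingularities.ResolutionOfSingularities.Theorems.SyzygyFlatteningHigherRankTerminationEssFiniteType
import Literature.AlgebraicGeometry.Resolution.AffineBlowupIntegral

/-!
# Kill test `SurfaceTermination` (stmt-ResolutionOfSingularities-16488), LINE genus-descent r7:
# the stub `stub_pgNonincreasing` — the geometric genus is NON-INCREASING along the canonical tower

`[OURS · L W4.4]` Cell res-hironaka, crux chain W4.4, kill test K4.4-s; U2e ASSEMBLY (res-D-pv-045) over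
U2a (res-L0-w44-stub-1: K1 dominating resolution, chart dictionary, chart resolution), the bricks of
res-L0-w44-stub-4 (GW-GLUE, GoodCover, length comparison, chart triangle), U2b/U2c/U2d and the core
`hasGeometricGenusLE_of_chart'` (`…GenusChart`, `…GenusCover`).  Nothing here is a statement of the
manuscript under review (Hironaka 2017); AI-written, weaker than expert review.

* `hasGeometricGenusLE_tower_succ_succ` — **`p_g(T_(m+2)) ≤ p_g(T_(m+1))`** in the line's vocabulary
  `HasGeometricGenusLE` (`…GenusDefs`): for the canonical `ca`-tower of a surface datum (`Frac A = K`,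
  `tr.deg_k K = 2`) and every valuation ring `O`, `HasGeometricGenusLE ↥T_(m+1) g → HasGeometricGenusLE
  ↥T_(m+2) g`, modulo Cossart–Jannsen–Saito (resolutions), Lipman (1.2) (domination step) and
  Görtz–Wedhorn 24.44-H² (gluing step).  Regular `T_(m+2)`: genus `0`.  Singular: the stage package, a
  resolution `ξ` of `T_(m+1)` with `ℓ Ȟ¹ ≤ g`, the U2a chart package (`σ_B : Z → Bl_{ca}(Spec T_(m+1))`, the
  chart `V = σ_B⁻¹ D₊(xt)`, the resolution `σ : V → Spec N` of the normalised chart ring `N` with its VALUES,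
  `T_(m+2) = loc O N` a localisation of `N`), the chart triangle `V.ι ≫ σ_B = σ ≫ Spec ψ ≫ chartι`, and
  `hasGeometricGenusLE_of_chart'`.
* `stub_pgNonincreasing` — the registered text `Sig.stub_pgNonincreasing` of the kill-test skeleton
  (LINE genus-descent r7 on stmt-16488, res-L0-w44-plan-1) BY NAME AND SIGNATURE, with its six-fact binder
  written out; the three prime-divisor hypotheses and three of the six facts are inert.

References: M. Artin, in *Arithmetic Geometry* (1986), Prop. (3.2)(i) (the printed Leray statement)
[`Artin1986`]; J. Lipman, Publ. IHÉS 36 (1969), Prop. (1.2) [`Lipman1969`]; U. Görtz, T. Wedhorn,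
*Algebraic Geometry II* (2023), Cor. 24.44 [`GortzWedhorn2023`]; V. Cossart, U. Jannsen, S. Saito, LNM 2270
(2020), Thm. 1.2 [`CossartJannsenSaito2020`].
-/

-- single-problem summit: the doubled namespace component `ResolutionOfSingularities` is forced
set_option linter.dupNamespace false

noncomputable section

open CategoryTheory CategoryTheory.Limits AlgebraicGeometry TopologicalSpace IsLocalRing
open Literature.AlgebraicGeometry.Resolution Literature.AlgebraicGeometry.Morphisms
open Summit.ResolutionOfSingularities.ResolutionOfSingularities.Theorems
open Summit.ResolutionOfSingularities.ResolutionOfSingularities.Theorems.NoZeno.Birth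
open Summit.ResolutionOfSingularities.ResolutionOfSingularities.Theorems.NoZeno.SandwichCluster
open Summit.ResolutionOfSingularities.ResolutionOfSingularities.Theorems.SurfaceTermination.ChartResolution

namespace Summit.ResolutionOfSingularities.ResolutionOfSingularities.Theorems.SurfaceTermination.GenusDescent

variable {k K : Type} [Field k] [Field K] [Algebra k K]

/-- Transport of `IsBirational` of the structure morphism along `Spec` of equal subalgebra inclusions is
not needed; this small lemma records that `Spec N → Spec T` is birational for `T ≤ N ⊆ T[1/x]`
(common denominator `x`). [cite: StacksProject, Tag 01RN] -/
theorem isBirational_specMap_inclusion (T N : Subalgebra k K) (hTN : T ≤ N) {x : ↥T} (hx0 : (x : K) ≠ 0)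
    (hden : ∀ y ∈ N, ∃ m : ℕ, (x : K) ^ m * y ∈ T) :
    IsBirational (Spec.map (CommRingCat.ofHom (Subalgebra.inclusion hTN).toRingHom)) := by
  letI : Algebra ↥T ↥N := (Subalgebra.inclusion hTN).toRingHom.toAlgebra
  have hinj : Function.Injective (algebraMap ↥T ↥N) := Subalgebra.inclusion_injective hTN
  have hx0' : x ≠ 0 := fun h => hx0 (by rw [h]; rfl)
  refine isBirational_specMap_of_denominator hinj x hx0' fun b => ?_
  obtain ⟨m, hm⟩ := hden b b.2
  refine ⟨m, ⟨_, hm⟩, Subtype.ext ?_⟩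
  change (x : K) ^ m * (b : K) = (((algebraMap ↥T ↥N x) ^ m * b : ↥N) : K)
  rfl

set_option maxHeartbeats 800000 in
-- the chart algebra `(T[It])_{(xt)}` is a homogeneous localisation: instance unification on it is slow
-- (same phenomenon as in `…ChartResolution`), hence the budget
/-- **`p_g(T_(m+2)) ≤ p_g(T_(m+1))` along the canonical tower** (see the module docstring).
[cite: Lipman1969, Proposition (1.2) (p. 199)] [cite: GortzWedhorn2023, Cor. 24.44]
[cite: CossartJannsenSaito2020, Thm. 1.2] [cite: Artin1986, Prop. (3.2)(i)] -/
theorem hasGeometricGenusLE_tower_succ_succ (hCJS : CossartJannsenSaito2020General.{0})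
    (h12 : Lipman1969_1_2.{0}) (hGW : GortzWedhorn2023_24_44_H2.{0})
    (O : ValuationSubring K) (A : Subalgebra k K) (hk : ∀ c : k, algebraMap k K c ∈ O) (hA : A.FG)
    (hfr : IsFractionRing ↥A K) (hAO : A.toSubring ≤ O.toSubring) (htr : Algebra.trdeg k K = 2)
    (m g : ℕ) (hg : HasGeometricGenusLE ↥(tower O A (m + 1)) g) :
    HasGeometricGenusLE ↥(tower O A (m + 1 + 1)) g := by
  classical
  haveI := hfr
  -- a regular next stage has genus `0`
  by_cases hreg' : IsRegularLocalRing ↥(tower O A (m + 1 + 1))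
  · haveI := hreg'
    exact hasGeometricGenusLE_mono (Nat.zero_le g)
      ((hasGeometricGenusLE_zero_iff _).mpr (hasRationalSingularity_of_isRegularLocalRing _))
  -- hence the stage `T = T_(m+1)` is singular too (a regular stage is terminal)
  have hsing : ¬ IsRegularLocalRing ↥(tower O A (m + 1)) := by
    intro hreg
    apply hreg'
    rw [tower_succ_eq_self_of_isRegularLocalRing O A hk hfr hAO (m + 1) hreg]
    exact hreg
  -- the stage package
  obtain ⟨hnoeth, hic, hfrT, hloc, hdimT, hET⟩ :=
    RationalDescent.stage_package_of_trdeg O A hk hA hfr hAO htr m hsing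
  haveI := hnoeth; haveI := hic; haveI := hfrT; haveI := hloc; haveI := hET
  have hTexc : IsExcellentRing ↥(tower O A (m + 1)) := (isExcellentRing_of_field k).of_essFiniteType hET
  have hTO : (tower O A (m + 1)).toSubring ≤ O.toSubring :=
    (tn_tower_invariant O A hk hA hfr hAO (m + 1)).2.1
  -- the given resolution with the genus bound
  obtain ⟨X, ξ, hξ, hbound⟩ := hg
  haveI : IsProper ξ := hξ.isProper
  -- an admissible denominator `x ∈ ca T`, `I = ca(↥T) ≠ 0`
  obtain ⟨x₀, hx₀, hx₀0, hadm⟩ := Thread.exists_admissible_tower O A hk hA hfr hAO (m + 1)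
  let x : ↥(tower O A (m + 1)) := ⟨x₀, ca_subset _ hx₀⟩
  have hxI : x ∈ Literature.RingTheory.CohomologyAnnihilator.cohomologyAnnihilator ↥(tower O A (m + 1)) :=
    (tn_coe_mem_ca_iff _ x).mp hx₀
  have hx0 : (x : K) ≠ 0 := hx₀0
  have hI : Literature.RingTheory.CohomologyAnnihilator.cohomologyAnnihilator ↥(tower O A (m + 1)) ≠ ⊥ :=
    fun h => hx₀0 (by
      have := hxI; rw [h, Ideal.mem_bot] at this; rw [show x₀ = (x : K) from rfl, this]; rfl)
  -- (K1) the dominating resolution and its lift to the blowing up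
  obtain ⟨Z, hZ, ρ, τX, hρ, hτξ, hτp, hτb, hCart⟩ :=
    exists_isResolution_dominating_of_cjsGeneral hCJS hTexc hdimT.le _ hI ξ hξ
  haveI := hZ
  haveI := hτp
  haveI : IsProper ρ := hρ.isProper
  let σB := (affineBlowup.isBlowup _).lift ρ hCart
  have hσB : σB ≫ affineBlowup.π _ = ρ := IsBlowup.lift_comp _ _ _
  haveI : IsProper σB := isProper_of_comp (tower O A (m + 1)) ρ σB hσB
  haveI hBint : IsIntegral (affineBlowup
      (Literature.RingTheory.CohomologyAnnihilator.cohomologyAnnihilator ↥(tower O A (m + 1)))) :=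
    affineBlowup.isIntegral hI
  have hπbir : IsBirational (affineBlowup.π
      (Literature.RingTheory.CohomologyAnnihilator.cohomologyAnnihilator ↥(tower O A (m + 1)))) :=
    affineBlowup.isBirational hI
  have hσBbir : IsBirational σB :=
    isBirational_of_comp' hπbir (by rw [hσB]; exact hρ.isBirational)
  -- dimensions
  have hdimSpec : topologicalKrullDim (Spec (.of ↥(tower O A (m + 1)))) ≤ 2 :=
    (le_of_eq (PrimeSpectrum.topologicalKrullDim_eq_ringKrullDim (R := ↥(tower O A (m + 1))))).trans
      hdimT.le
  have hdimZ : topologicalKrullDim Z ≤ 2 := by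
    rw [hρ.isBirational.topologicalKrullDim_eq_of_isProper]; exact hdimSpec
  have hdimB : topologicalKrullDim (affineBlowup
      (Literature.RingTheory.CohomologyAnnihilator.cohomologyAnnihilator ↥(tower O A (m + 1)))) ≤ 2 := by
    rw [hπbir.topologicalKrullDim_eq_of_isProper]; exact hdimSpec
  -- (K2) the chart resolution with its values
  obtain ⟨e, he⟩ := exists_functionField_ringEquiv (tower O A (m + 1)) ρ hρ.isBirational
  obtain ⟨hne, σ, hσval, hσc, hσres⟩ :=
    exists_isResolution_chartMorphism (tower O A (m + 1)) ρ e he σB hσB hxI hρ hx0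
  -- the normalised chart ring `N = nrm (k[T ∪ I·x⁻¹])` (written out literally below)
  have hTN : tower O A (m + 1) ≤ (nrm (Algebra.adjoin k (((tower O A (m + 1)) : Set K) ∪
      {y : K | ∃ c : ↥(tower O A (m + 1)),
        c ∈ Literature.RingTheory.CohomologyAnnihilator.cohomologyAnnihilator ↥(tower O A (m + 1)) ∧
          y = (c : K) * (x : K)⁻¹}))) := le_nrm_adjoin (tower O A (m + 1))
  haveI hCfrac : IsFractionRing ↥(Algebra.adjoin k (((tower O A (m + 1)) : Set K) ∪
      {y : K | ∃ c : ↥(tower O A (m + 1)),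
        c ∈ Literature.RingTheory.CohomologyAnnihilator.cohomologyAnnihilator ↥(tower O A (m + 1)) ∧
          y = (c : K) * (x : K)⁻¹})) K :=
    isFractionRing_subalgebra_of_le (tower O A (m + 1)) _ fun y hy => Algebra.subset_adjoin (Or.inl hy)
  have hCeft : Algebra.EssFiniteType k ↥(Algebra.adjoin k (((tower O A (m + 1)) : Set K) ∪
      {y : K | ∃ c : ↥(tower O A (m + 1)),
        c ∈ Literature.RingTheory.CohomologyAnnihilator.cohomologyAnnihilator ↥(tower O A (m + 1)) ∧
          y = (c : K) * (x : K)⁻¹})) := by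
    have h := HomologicalConductor.PersistenceAffineChartEssFiniteType.stub_affineChartEssFiniteType k K
      (tower O A (m + 1)) (x : K) hET
    rw [← HomologicalConductor.PersistenceRadical.ca_eq_image, setOf_ca_mul_inv_eq] at h
    exact h
  have hNeft : Algebra.EssFiniteType k ↥(nrm (Algebra.adjoin k (((tower O A (m + 1)) : Set K) ∪
      {y : K | ∃ c : ↥(tower O A (m + 1)),
        c ∈ Literature.RingTheory.CohomologyAnnihilator.cohomologyAnnihilator ↥(tower O A (m + 1)) ∧
          y = (c : K) * (x : K)⁻¹}))) :=
    SyzygyFlattening.stub_essFiniteType_nrm k K _ hCfrac hCeft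
  haveI hNnoeth : IsNoetherianRing ↥(nrm (Algebra.adjoin k (((tower O A (m + 1)) : Set K) ∪
      {y : K | ∃ c : ↥(tower O A (m + 1)),
        c ∈ Literature.RingTheory.CohomologyAnnihilator.cohomologyAnnihilator ↥(tower O A (m + 1)) ∧
          y = (c : K) * (x : K)⁻¹}))) :=
    Algebra.EssFiniteType.isNoetherianRing k _
  haveI hNic : IsIntegrallyClosed ↥(nrm (Algebra.adjoin k (((tower O A (m + 1)) : Set K) ∪
      {y : K | ∃ c : ↥(tower O A (m + 1)),
        c ∈ Literature.RingTheory.CohomologyAnnihilator.cohomologyAnnihilator ↥(tower O A (m + 1)) ∧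
          y = (c : K) * (x : K)⁻¹}))) :=
    SyzygyFlattening.isIntegrallyClosed_nrm _
  -- the chart morphism `τ`, the value map `ψ`, and `ν = Spec ψ ≫ chartι`
  obtain ⟨τ, hτ, -⟩ := exists_chartHom (tower O A (m + 1)) ρ σB hσB hxI
  have hη := genericPoint_mem_image_top (σB ⁻¹ᵁ (affineBlowup.chartOpen x hxI).1) hne
  have hIN : ∀ c : ↥(tower O A (m + 1)),
      c ∈ Literature.RingTheory.CohomologyAnnihilator.cohomologyAnnihilator ↥(tower O A (m + 1)) →
        (c : K) * (x : K)⁻¹ ∈ (nrm (Algebra.adjoin k (((tower O A (m + 1)) : Set K) ∪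
      {y : K | ∃ c : ↥(tower O A (m + 1)),
        c ∈ Literature.RingTheory.CohomologyAnnihilator.cohomologyAnnihilator ↥(tower O A (m + 1)) ∧
          y = (c : K) * (x : K)⁻¹}))) := fun c hc =>
    SyzygyFlattening.self_le_nrm _ (Algebra.subset_adjoin (Or.inr ⟨c, hc, rfl⟩))
  obtain ⟨ψ, hψ⟩ := exists_chartRingHom (tower O A (m + 1)) ρ e he σB hσB hxI τ hτ hη hx0 _ hTN hIN
  have hνC : Set.range (Spec.map ψ ≫ affineBlowup.chartι x hxI).base ⊆
      ((affineBlowup.chartOpen x hxI).1 : Set _) := by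
    rintro _ ⟨n, rfl⟩
    have h1 : (Spec.map ψ ≫ affineBlowup.chartι x hxI).base n ∈
        Set.range (affineBlowup.chartι (I := _) x hxI) := by
      rw [Scheme.Hom.comp_base, TopCat.coe_comp, Function.comp_apply]
      exact ⟨_, rfl⟩
    rw [range_chartι_eq (tower O A (m + 1)) hxI, Scheme.Opens.range_ι] at h1
    exact h1
  have htri : σ ≫ (Spec.map ψ ≫ affineBlowup.chartι x hxI) =
      (σB ⁻¹ᵁ (affineBlowup.chartOpen x hxI).1).ι ≫ σB :=
    (ι_comp_eq_comp_specMap_chartι e σB hxI τ hτ hη _ ψ hψ σ hσval).symm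
  -- the `T`-structure of the chart
  letI algTN : Algebra ↥(tower O A (m + 1)) ↥(nrm (Algebra.adjoin k (((tower O A (m + 1)) : Set K) ∪
      {y : K | ∃ c : ↥(tower O A (m + 1)),
        c ∈ Literature.RingTheory.CohomologyAnnihilator.cohomologyAnnihilator ↥(tower O A (m + 1)) ∧
          y = (c : K) * (x : K)⁻¹}))) := (Subalgebra.inclusion hTN).toRingHom.toAlgebra
  have hσT : (σB ⁻¹ᵁ (affineBlowup.chartOpen x hxI).1).ι ≫ (τX ≫ ξ) =
      σ ≫ Spec.map (CommRingCat.ofHom (algebraMap ↥(tower O A (m + 1)) ↥(nrm (Algebra.adjoin k (((tower O A (m + 1)) : Set K) ∪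
      {y : K | ∃ c : ↥(tower O A (m + 1)),
        c ∈ Literature.RingTheory.CohomologyAnnihilator.cohomologyAnnihilator ↥(tower O A (m + 1)) ∧
          y = (c : K) * (x : K)⁻¹}))))) := by
    rw [hτξ]; exact hσc
  have hσBρ : σB ≫ affineBlowup.π _ = τX ≫ ξ := by rw [hσB, hτξ]
  -- the next stage is the localisation of `N` at the centre
  have hsucc := tower_succ_eq_loc_nrm_adjoin O A (m + 1) hTO x hx₀ hx0 hadm
  have hNT : (nrm (Algebra.adjoin k (((tower O A (m + 1)) : Set K) ∪
      {y : K | ∃ c : ↥(tower O A (m + 1)),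
        c ∈ Literature.RingTheory.CohomologyAnnihilator.cohomologyAnnihilator ↥(tower O A (m + 1)) ∧
          y = (c : K) * (x : K)⁻¹}))) ≤ tower O A (m + 1 + 1) := by
    rw [hsucc]; exact SyzygyFlattening.self_le_locAt O _
  have hNO : (nrm (Algebra.adjoin k (((tower O A (m + 1)) : Set K) ∪
      {y : K | ∃ c : ↥(tower O A (m + 1)),
        c ∈ Literature.RingTheory.CohomologyAnnihilator.cohomologyAnnihilator ↥(tower O A (m + 1)) ∧
          y = (c : K) * (x : K)⁻¹}))).toSubring ≤ O.toSubring :=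
    fun y hy => (tn_tower_invariant O A hk hA hfr hAO (m + 1 + 1)).2.1 (hNT hy)
  -- conclude for any `T'` equal to `loc O N` (so that the stage itself can be substituted)
  have key : ∀ (T' : Subalgebra k K) (hT' : T' = SyzygyFlattening.locAt O (nrm (Algebra.adjoin k (((tower O A (m + 1)) : Set K) ∪
      {y : K | ∃ c : ↥(tower O A (m + 1)),
        c ∈ Literature.RingTheory.CohomologyAnnihilator.cohomologyAnnihilator ↥(tower O A (m + 1)) ∧
          y = (c : K) * (x : K)⁻¹})))),
      HasGeometricGenusLE ↥T' g := by
    intro T' hT'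
    subst hT'
    letI algNT : Algebra ↥(nrm (Algebra.adjoin k (((tower O A (m + 1)) : Set K) ∪
      {y : K | ∃ c : ↥(tower O A (m + 1)),
        c ∈ Literature.RingTheory.CohomologyAnnihilator.cohomologyAnnihilator ↥(tower O A (m + 1)) ∧
          y = (c : K) * (x : K)⁻¹}))) ↥(SyzygyFlattening.locAt O (nrm (Algebra.adjoin k (((tower O A (m + 1)) : Set K) ∪
      {y : K | ∃ c : ↥(tower O A (m + 1)),
        c ∈ Literature.RingTheory.CohomologyAnnihilator.cohomologyAnnihilator ↥(tower O A (m + 1)) ∧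
          y = (c : K) * (x : K)⁻¹})))) :=
      (Subalgebra.inclusion (SyzygyFlattening.self_le_locAt O (nrm (Algebra.adjoin k (((tower O A (m + 1)) : Set K) ∪
      {y : K | ∃ c : ↥(tower O A (m + 1)),
        c ∈ Literature.RingTheory.CohomologyAnnihilator.cohomologyAnnihilator ↥(tower O A (m + 1)) ∧
          y = (c : K) * (x : K)⁻¹}))))).toRingHom.toAlgebra
    haveI hL := SyzygyFlattening.isLocalization_locAt O (nrm (Algebra.adjoin k (((tower O A (m + 1)) : Set K) ∪
      {y : K | ∃ c : ↥(tower O A (m + 1)),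
        c ∈ Literature.RingTheory.CohomologyAnnihilator.cohomologyAnnihilator ↥(tower O A (m + 1)) ∧
          y = (c : K) * (x : K)⁻¹}))) hNO
    exact hasGeometricGenusLE_of_chart' hdimT.le h12 hGW ξ hξ g hbound τX hτb hρ.isRegular hdimZ
      (affineBlowup.π _) hπbir hdimB σB hσBbir hσBρ (affineBlowup.chartOpen x hxI).1
      (affineBlowup.chartOpen x hxI).2 (Spec.map ψ ≫ affineBlowup.chartι x hxI) hνC σ hσres htri hσT
      ↥(SyzygyFlattening.locAt O (nrm (Algebra.adjoin k (((tower O A (m + 1)) : Set K) ∪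
      {y : K | ∃ c : ↥(tower O A (m + 1)),
        c ∈ Literature.RingTheory.CohomologyAnnihilator.cohomologyAnnihilator ↥(tower O A (m + 1)) ∧
          y = (c : K) * (x : K)⁻¹}))))
      ((IsUnit.submonoid ↥(SyzygyFlattening.locAt O (nrm (Algebra.adjoin k (((tower O A (m + 1)) : Set K) ∪
      {y : K | ∃ c : ↥(tower O A (m + 1)),
        c ∈ Literature.RingTheory.CohomologyAnnihilator.cohomologyAnnihilator ↥(tower O A (m + 1)) ∧
          y = (c : K) * (x : K)⁻¹}))))).comap
        (Subalgebra.inclusion (SyzygyFlattening.self_le_locAt O (nrm (Algebra.adjoin k (((tower O A (m + 1)) : Set K) ∪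
      {y : K | ∃ c : ↥(tower O A (m + 1)),
        c ∈ Literature.RingTheory.CohomologyAnnihilator.cohomologyAnnihilator ↥(tower O A (m + 1)) ∧
          y = (c : K) * (x : K)⁻¹}))))))
  exact key (tower O A (m + 1 + 1)) hsucc

/-- **Stub `stub_pgNonincreasing` of the kill-test skeleton (LINE genus-descent r7 on stmt-16488,
res-L0-w44-plan-1) BY NAME AND SIGNATURE** — `Sig.stub_pgNonincreasing` verbatim with its leading
six-fact binder written out: modulo the crux's named-fact bundle, along a prime divisor the geometric
genus is non-increasing along the canonical tower, `p_g(T_(m+2)) ≤ p_g(T_(m+1))`.  Used: Cossart–Jannsen–Saito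
(resolutions), Lipman (1.2) (domination step), Görtz–Wedhorn 24.44-H² (Leray gluing); Lipman (4.1),
(12.1)(i)/(ii) and the three prime-divisor hypotheses are inert.  OURS; not a statement of Hironaka 2017.
[cite: Artin1986, Prop. (3.2)(i)] [cite: Lipman1969, Proposition (1.2) (p. 199)]
[cite: GortzWedhorn2023, Cor. 24.44] [cite: CossartJannsenSaito2020, Thm. 1.2] -/
theorem stub_pgNonincreasing
    (hF : (Literature.AlgebraicGeometry.Resolution.CossartJannsenSaito2020General.{0} ∧
      Literature.AlgebraicGeometry.Resolution.Lipman1969_1_2.{0} ∧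
      Literature.AlgebraicGeometry.Resolution.Lipman1969_4_1.{0} ∧
      Literature.AlgebraicGeometry.Resolution.Lipman1969_12_1_i.{0} ∧
      Literature.AlgebraicGeometry.Resolution.Lipman1969_12_1_ii.{0} ∧
      Literature.AlgebraicGeometry.Morphisms.GortzWedhorn2023_24_44_H2.{0})) :
    ∀ p : ℕ, p.Prime → ∀ (k K : Type) [Field k] [CharP k p] [Field K] [Algebra k K]
    (O : ValuationSubring K) (A : Subalgebra k K) (hk : ∀ c : k, algebraMap k K c ∈ O), A.FG →
    IsFractionRing ↥A K → A.toSubring ≤ O.toSubring → ringKrullDim ↥A = 2 →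
    O ≠ ⊤ → IsDiscreteValuationRing ↥O → residueTrdeg k O hk + 1 = Algebra.trdeg k K →
    ∀ g m : ℕ, HasGeometricGenusLE ↥(tower O A (m + 1)) g →
      HasGeometricGenusLE ↥(tower O A (m + 1 + 1)) g := by
  intro p _ k K _ _ _ _ O A hk hA hfr hAO hdimA _ _ _ g m hg
  haveI := hfr
  exact hasGeometricGenusLE_tower_succ_succ hF.1 hF.2.1 hF.2.2.2.2.2 O A hk hA hfr hAO
    (SurfaceTermination.Descent.trdeg_eq_two_of_ringKrullDim A hA hfr hdimA) m g hg

end Summit.ResolutionOfSingularities.ResolutionOfSingularities.Theorems.SurfaceTermination.GenusDescent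

end
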